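import Summits.BirchSwinnertonDyer.Rank1Residual.GaloisImage.EPCMultiplicative
import Summits.BirchSwinnertonDyer.Rank1Residual.GaloisImage.ModPLatticeHerbrandCount
import Literature.NumberTheory.GaloisRepresentations.LocalFieldCdTwo
import Literature.NumberTheory.GaloisRepresentations.PPrimaryDevissage
import Mathlib.GroupTheory.Perm.Cycle.Type
import Mathlib.LinearAlgebra.Quotient.Card
import HarnessLib

/-!
# Reduction of Tate's local Euler–Poincaré formula to modules killed by a prime
# (cell `b2b-bsdres`, team n1011, row T-EPC = Tate's local Euler–Poincaré characteristic; seat p04 GEN 8; stage D2)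

HONEST FRAMING (cell `b2b-bsdres`, run/shared/lean/b2b/bsd-rank1-residual/, verbatim in every
file): the goal of the cell is to DELETE the COMBINATION-SHAPED residual classes of the
Birch–Swinnerton-Dyer formula for ALL analytic-rank `≤ 1` elliptic curves over `ℚ` — "full BSD
formula for every rank `≤ 1` curve in class `C`" assembled STRICTLY from published theorems — so
that the rank-`≤ 1` remainder becomes exactly the CONSTRUCTION-SHAPED classes, which are TYPED
(missing-input `Prop`s), NOT attempted. This is not "finishing BSD". Team n1011 (N10 / N11, the
additive block X4 ∧ `p = 3`): research route; no claim beyond the stated classes; nothing is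
booked; no mark / label is changed by this file. Theorems only (no definition, no named fact, no
`sorry`).  (Placement: Summits/GaloisImage with the T-EPC cone.)

## What

Milne, *ADT* I Thm. 2.8, proof: "We may assume `M` is killed by a prime" — induction on `#M`
through `0 → M[ℓ] → M → M/M[ℓ] → 0` with the multiplicativity of stage D1
(`EPCMul.localEPC_of_isSES`; `H³(F, M[ℓ]) = 0` by `cd_ℓ Γ_F ≤ 2`, tree `LocalFieldCdTwo`):

* `EPCMul.localEPC_of_subsingleton` — the formula for `M = 0`;
* `EPCMul.localEPC_of_forall_prime` — **if Tate's formula holds for every finite discrete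
  `Γ_F`-module killed by a prime, it holds for every finite discrete `Γ_F`-module**.

References: J. S. Milne, *Arithmetic Duality Theorems* (2006), I §2 Thm. 2.8 [MilneADT2006];
J.-P. Serre, *Galois Cohomology* (1997), II §5.7 [SerreGaloisCohomology1997].
-/

noncomputable section

open CategoryTheory Function Field
open scoped ValuativeRel
open Literature.NumberTheory.GaloisRepresentations

universe u

namespace Summit.BirchSwinnertonDyer.Rank1Residual.GaloisImage

namespace EPCMul

variable (F : Type u) [Field F] [ValuativeRel F] [TopologicalSpace F] [IsNonarchimedeanLocalField F]
  [CharZero F]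

omit [TopologicalSpace F] [IsNonarchimedeanLocalField F] [CharZero F] in
/-- Tate's formula for the zero module: `1 · 1 · #(𝒪/(1)) = 1`. [folklore] -/
theorem localEPC_of_subsingleton {M : Type u} [AddCommGroup M] [TopologicalSpace M] [DiscreteTopology M]
    [Subsingleton M] (ρ : ContinuousRep (absoluteGaloisGroup F) ℤ M) :
    Finite (continuousCohomology 1 ρ.toTopRep) ∧ Finite (continuousCohomology 2 ρ.toTopRep) ∧
      Nat.card ρ.toTopRep.ρ.invariants * Nat.card (continuousCohomology 2 ρ.toTopRep) *
          Nat.card (𝒪[F] ⧸ Ideal.span {((Nat.card M : ℕ) : 𝒪[F])}) =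
        Nat.card (continuousCohomology 1 ρ.toTopRep) := by
  haveI : Subsingleton ρ.toTopRep := ‹Subsingleton M›
  haveI h1 := subsingleton_continuousCohomology_of_subsingleton ρ.toTopRep 0
  haveI h2 := subsingleton_continuousCohomology_of_subsingleton ρ.toTopRep 1
  haveI : Subsingleton ρ.toTopRep.ρ.invariants := inferInstance
  refine ⟨Finite.of_subsingleton, Finite.of_subsingleton, ?_⟩
  rw [Nat.card_of_subsingleton (0 : ρ.toTopRep.ρ.invariants),
    Nat.card_of_subsingleton (0 : continuousCohomology 2 ρ.toTopRep),
    Nat.card_of_subsingleton (0 : continuousCohomology 1 ρ.toTopRep), Nat.card_of_subsingleton (0 : M),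
    Nat.cast_one, Ideal.span_singleton_one]
  haveI : Subsingleton (𝒪[F] ⧸ (⊤ : Ideal 𝒪[F])) := Ideal.Quotient.subsingleton_iff.2 rfl
  rw [Nat.card_of_subsingleton (0 : 𝒪[F] ⧸ (⊤ : Ideal 𝒪[F]))]

/-- **Reduction to modules killed by a prime**: if Tate's local Euler–Poincaré formula holds for
every finite discrete `Γ_F`-module killed by a prime, it holds for every finite discrete
`Γ_F`-module (induction on `#M` through `0 → M[ℓ] → M → M/M[ℓ] → 0`, `H³(F, M[ℓ]) = 0` by
`cd Γ_F ≤ 2`, multiplicativity `localEPC_of_isSES`). [cite: MilneADT2006, I §2 Thm 2.8 (proof)] -/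
theorem localEPC_of_forall_prime
    (H : ∀ (ℓ : ℕ) [Fact ℓ.Prime] {M : Type u} [AddCommGroup M] [TopologicalSpace M] [DiscreteTopology M]
      [Finite M] (ρ : ContinuousRep (absoluteGaloisGroup F) ℤ M), (∀ m : M, ℓ • m = 0) →
      Finite (continuousCohomology 1 ρ.toTopRep) ∧ Finite (continuousCohomology 2 ρ.toTopRep) ∧
        Nat.card ρ.toTopRep.ρ.invariants * Nat.card (continuousCohomology 2 ρ.toTopRep) *
            Nat.card (𝒪[F] ⧸ Ideal.span {((Nat.card M : ℕ) : 𝒪[F])}) =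
          Nat.card (continuousCohomology 1 ρ.toTopRep))
    {M : Type u} [AddCommGroup M] [TopologicalSpace M] [DiscreteTopology M] [Finite M]
    (ρ : ContinuousRep (absoluteGaloisGroup F) ℤ M) :
    Finite (continuousCohomology 1 ρ.toTopRep) ∧ Finite (continuousCohomology 2 ρ.toTopRep) ∧
      Nat.card ρ.toTopRep.ρ.invariants * Nat.card (continuousCohomology 2 ρ.toTopRep) *
          Nat.card (𝒪[F] ⧸ Ideal.span {((Nat.card M : ℕ) : 𝒪[F])}) =
        Nat.card (continuousCohomology 1 ρ.toTopRep) := by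
  -- strong induction on `#M`
  suffices key : ∀ (k : ℕ) {M : Type u} [AddCommGroup M] [TopologicalSpace M] [DiscreteTopology M]
      [Finite M] (ρ : ContinuousRep (absoluteGaloisGroup F) ℤ M), Nat.card M = k →
      Finite (continuousCohomology 1 ρ.toTopRep) ∧ Finite (continuousCohomology 2 ρ.toTopRep) ∧
        Nat.card ρ.toTopRep.ρ.invariants * Nat.card (continuousCohomology 2 ρ.toTopRep) *
            Nat.card (𝒪[F] ⧸ Ideal.span {((Nat.card M : ℕ) : 𝒪[F])}) =
          Nat.card (continuousCohomology 1 ρ.toTopRep) from key _ ρ rfl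
  intro k
  induction k using Nat.strong_induction_on with
  | _ k ih =>
  intro M _ _ _ _ ρ hk
  classical
  by_cases hsub : Subsingleton M
  · exact localEPC_of_subsingleton F ρ
  haveI : Nontrivial M := not_subsingleton_iff_nontrivial.1 hsub
  letI := Fintype.ofFinite M
  -- a prime `ℓ` with an element of order `ℓ`
  have hM1 : Fintype.card M ≠ 1 := Fintype.one_lt_card.ne'
  obtain ⟨ℓ, hℓ, hℓd⟩ := Nat.exists_prime_and_dvd hM1
  haveI : Fact ℓ.Prime := ⟨hℓ⟩
  obtain ⟨x, hx⟩ := exists_prime_addOrderOf_dvd_card ℓ hℓd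
  -- `W = M[ℓ]`
  set W : Submodule ℤ M := LinearMap.ker (LinearMap.lsmul ℤ M ℓ) with hWdef
  have hW : ∀ g, W ≤ W.comap (ρ g) := fun g => ModPRepCount.ker_lsmul_le_comap ρ.toRepresentation ℓ g
  have hxW : x ∈ W := by
    rw [hWdef, LinearMap.mem_ker, LinearMap.lsmul_apply, natCast_zsmul, ← hx]
    exact addOrderOf_nsmul_eq_zero x
  have hx0 : x ≠ 0 := by
    intro h
    rw [h, addOrderOf_zero] at hx
    exact hℓ.one_lt.ne' hx.symm
  -- the pieces
  have hWℓ : ∀ w : W, ℓ • w = 0 := fun w => by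
    have hw : (w : M) ∈ LinearMap.ker (LinearMap.lsmul ℤ M ℓ) := by rw [← hWdef]; exact w.2
    rw [LinearMap.mem_ker, LinearMap.lsmul_apply, natCast_zsmul] at hw
    exact Subtype.ext hw
  have hA := H ℓ (ρ.subrepresentation W hW) hWℓ
  have hcardW : 1 < Nat.card W :=
    Finite.one_lt_card_iff_nontrivial.2 ⟨⟨⟨x, hxW⟩, 0, fun h => hx0 (congrArg Subtype.val h)⟩⟩
  have hC : Nat.card (M ⧸ W) < k := by
    have hmul : Nat.card M = Nat.card W * Nat.card (M ⧸ W) := Submodule.card_eq_card_quotient_mul_card W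
    rw [← hk, hmul]
    exact lt_mul_left Nat.card_pos hcardW
  have hQ := ih _ hC (ρ.quotient W hW) rfl
  haveI : Subsingleton (continuousCohomology 3 (ρ.subrepresentation W hW).toTopRep) :=
    subsingleton_continuousCohomology_of_two_lt F (ρ.subrepresentation W hW)
      (fun w => ⟨1, by rw [pow_one]; exact hWℓ w⟩) (by norm_num)
  exact localEPC_of_isSES F (isSES_subtype_mkQ ρ W hW) hA hQ

end EPCMul

end Summit.BirchSwinnertonDyer.Rank1Residual.GaloisImage

end
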